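import Summits.QuantumFields.YangMills.Theorems.BalabanUVNodesN17RunRemAtOfShiftAnchorLevel
import Summits.QuantumFields.YangMills.Theorems.BalabanUVNodesK2NamedJetsLimit

/-!
# NODE N17 (NE4) — SUPPLIER ROAD TO K2⁷, FILE 5: THE RUN-KEYED (SLIDING-WINDOW) EDITION OF THE LEVER — node N17's scale shift read ONLY ALONG IN-WINDOW RG RUNS of
# (0.20) ⟹ DEF-1's run letter `RunRemAt` ∕ the registered 2ᴮ″ text `RunRemAtSomeJets` BY NAME; the corner step of the NAMED one-loop numbers is HYPOTHESIS-FREE (tree)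

Cell `pub-ymgap`, YM-PLAN Track A (HUMAN RULINGS D-0062 ∕ D-0149), WIDTH SEAT `pub-ymgap-dag-n17-w1` (generation 4).  Key K3⁷ stmt-QuantumFields-20544
(`--kind proof --supports 20544 --as helper`, COUNT-NEUTRAL); via node N17 also K2⁷ stmt-QuantumFields-20543 (skeleton v6 5a75a2378c79b303: 2ᴮ″
`stub_runRemNamedJets13 : RunRemAtSomeJets`, 1ᴬ `stub_d1AnchoredJets13 : D1AtAnchoredJets`; texts = tree defs of DEF-1's `Thm/BalabanUVNodesK2V6Defs`, p603331).
Continues FILE 1 (p600401, `…N17RunRemAtOfShiftAnchor`: lever from the BOX letter), FILE 2 (p602302, `…Level`: (C) ANTITONE in the level) and FILE 3 (p603839, `…N17D1OfNamedLimit`).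

WHY THIS FILE (the question it answers).  The nodeO critics' F4∕F5 (idea-4 g5 `Cruxes/EndpointGivenBR13SepCoPH/F4-LASTSLOT-idea4g5.md` §5, CRIT-1 g4
`…/CRIT-1-runs-given-b-ed5.md` §3–§5, bus NODEO-CRIT1-G4-F4CONFIRM addressed to this seat): node N17's letter `N17At D u := NE4OnData D … := T4CouplingMatching.ScaleShiftRate c ρ γ D.βfun`
is keyed BOX-WISE with `Fin.tail` — `∀ k (w ∈ Box γ (k+1)), |β (k+1) w − β k (Fin.tail w)| ≤ c·ρ^k` — i.e. it reads the record's β at EVERY history of the box (BN-F N3: off-run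
histories) and compares the `(k+2)`-step construction with the IR-matched `(k+1)`-step one (`Fin.tail` drops the finest coupling: in the action layer's dictionary a
gauge-fixing weight is promoted to a bare coupling).  FILE 1's lever CONSUMES the letter in exactly that strength (iterated `Fin.tail` over a whole small box, `rem_iterate_of_remShift`)
and restricts to runs only at the output (`runConstRemainder_of_constRemainder`).  THIS FILE re-keys the INPUT: the SAME telescoping lands DIRECTLY on DEF-1's RUN letter
`RunConstRemainder` when the shift modulus is read only along SLIDING WINDOWS `(g_j, …, g_{j+k+1})` of IN-WINDOW RUNS of (0.20) (`RGEqH ∧ Step.InInterval`, F4's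
admissible class (i) «values at in-window run prefixes ∕ functionals of the run»), plus a summable CORNER STEP `|b_{k+1} − b_k| ≤ e_k` of the reference numbers (joint-corner data,
F4 (ii)).  And AT THE NAMED JETS `b := θ.cβ • beta0OfJs F κ` the corner step is FREE and HYPOTHESIS-FREE: the named one-loop numbers converge geometrically for EVERY colour
datum (pub-balaban-gaps g1-p3's `Gaps.CapTailPinnedLimitSign.exists_geomRate_pinned` over gan24-p1's all-scales rate; the convergence ∕ drift junctions are cited BY NAME from
ym-nodeO-d1-w1's `Thm/BalabanUVNodesK2NamedJetsLimit` = PORT-2 of idea-7 g5's `CornerLimitSignSketch.lean` §9.1 — `tendsto_beta0OfJs`, `drift_iff_tendsto_stepBal`).  So (★★):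
  admissible θ · RUN-WINDOW shift modulus of `(datumOfRecord₁₃SepCoPH F 2 θ hP).βfun` at level `θ.γ` with `Σ a_k < ∞` · `ScaleAnchor … (θ.cβ • beta0OfJs F κ)` · `SurvCont` at ONE level
  ⟹ `RunRemAt F κ θ hP θ.cβ` (NO box letter, NO corner-step hypothesis),
and at text level (★★★) the registered 2ᴮ″ `RunRemAtSomeJets` BY NAME from the run-window text + «∃ κ, ScaleAnchor ∧ ∃ γ₀ > 0, SurvCont», and the crux decl
`EndpointGivenBR13SepCoPH` BY NAME with «lim = stepBal 2 F.L» added at that κ.  The BOX letter implies both run-keyed inputs (`runWindowShift_of_boxShift` +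
FILE 1's `abs_sub_succ_le_of_shiftModulus_scaleAnchor`), so FILE 1∕2's theorems FACTOR through this file (`exists_runConstRemainder_of_boxShift_scaleAnchor`, `runWindowShift_of_n17At`).

WHAT A RUN WINDOW READS (honest dictionary, F4's action layer: slot 0 = bare coupling + GF₀ weight, slot j ≥ 1 = GF_j weight, running coupling run-generated).  A window
`(g_j, …, g_{j+k})` of an honest run fed to `β k` reads «bare coupling := the run's OWN scale-j running coupling, GF slots := the run's OWN later couplings» — on print's runs
(GF weight at step i = the running g_i) this is the k-step run data iff the truncated honest run is a run of the truncated system, which is exactly NE4's physical content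
(«one more UV scale at IR-matched couplings», pv16's docstring of `ScaleShiftRate`) made visible instead of asserted box-wide.  The fully TWO-RUN edition (the second history an
honest run of the record from the first run's scale-1 coupling) needs in addition a window-stability side letter (forward runs from `g₁` stay in `]0, γ₀]`) — LOCATED, not typed here.

FILE 3 CORRECTED (located, by name): `…K2NamedJetsLimit.drift_iff_tendsto_stepBal F κ 2` is FILE 3's `exists_oneLoopDrift_iff_tendsto_stepBal_of_n17At_scaleAnchor` with NO N17
and NO anchor — both hypotheses are IDLE there (and in `d1AtAnchoredJets_iff_limitAtAnchoredJets_of_n17AtRecord13`, = `…K2NamedJetsLimit.d1AtAnchoredJets_iff_tendstoAtAnchoredJets`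
hypothesis-free); FILE 3 §2's clause «the EXISTENCE of the named limit is node N17's + the anchor's» is withdrawn (existence is hypothesis-free; N17 + anchor give the RATE in N17's
letters and, for ARBITRARY anchoring sequences, convergence at all).

WHAT THIS FILE PROVES (theorems only; 0 `def`, 0 `instance`, 0 `sorry`; hypothesis TEXTS spelled inline): §1 the generic run-keyed lever (`β : HBeta`) up to
★ `exists_runConstRemainder_of_runWindowShift_cornerStep_scaleAnchor` and ★ `endpointExistence_of_runWindowShift_cornerStep_scaleAnchor_drift_survContAt`; §2 the corner step of the
named numbers, hypothesis-free; §3 ★★ `runRemAt_of_runWindowShift_scaleAnchor_survContAt` (+ iff, + N17 ⟹ run windows); §4 texts ★★★ `runRemAtSomeJets_of_runWindowShift13_anchorSurv13`,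
★★★ `EndpointGivenBR13SepCoPH_of_runWindowShift13_anchorSurvLimit13`.

HONEST SCOPE (A6, director-ym №189).  Elementary real bookkeeping over hypothesis SHAPES + three tree facts BY NAME; the run-window shift text is a HYPOTHESIS inhabited at no θ
here (instance 0∕1), NOT a registered stub and NOT proposed for registration (the plan's ∕ node U3's owners' call); §3–§4 quantify over `θ : Stage13HParams F 2` with
`hP : θ.Provisos₁₃SepCoPH F 2` — inhabited iff K0⁷ (stmt-QuantumFields-20541).  NOTHING of Bałaban is asserted or instantiated: NE4 NOT IN PRINT ([Balaban1987RG1] p. 264; GAPS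
G-t4-U2-1) and NOT proved in any keying; the anchor's identification, (C) and row (D1) NOT proved; NOT a proof of `stub_runRemNamedJets13`, `stub_d1AnchoredJets13`, `stub_rates13H`
or any stub; N17 NOT discharged (DEPENDENT∕DERIVED row); K2⁷ ∕ K3⁷ OPEN; counts UNMOVED (typed 28∕28 · discharged 5∕27 · A 5∕28).  One finite four-torus programme at fixed
`ε = L^{−K}`, Bałaban AS PRINTED; the YM mass gap (Clay) is NOT proved by any of this — R4 closes the conditional finite-𝕋⁴ rung `BalabanLadder.UV` only; nothing continuum ∕ ℝ⁴ ∕ OS.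
[I] = [Balaban1987RG1] T. Bałaban, CMP **109** (1987): Thm 2 p. 259, (0.20) p. 256, (1.3) p. 260, (1.20)–(1.22) p. 264, Thm 3 p. 264, (2.12)–(2.14) p. 268, §5 p. 298.
-/

noncomputable section

namespace Summit.QuantumFields.YangMills.BalabanUVNodes.N17RunWindowShift

open Literature.MathematicalPhysics.QuantumFieldTheory.Balaban1983to89
open Literature.MathematicalPhysics.QuantumFieldTheory.Balaban1983to89.FlowStep
open Literature.MathematicalPhysics.QuantumFieldTheory.Balaban1983to89.T4CouplingMatching (ScaleShiftRate)
open Literature.MathematicalPhysics.QuantumFieldTheory.Balaban1983to89.B12Beta (HistBox)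
open Literature.MathematicalPhysics.QuantumFieldTheory.Balaban1983to89.DagBinding (EndpointExistence ForwardGenerated)
open Literature.MathematicalPhysics.QuantumFieldTheory.Balaban1983to89.T4Continuum (T4Family)
open Literature.MathematicalPhysics.QuantumFieldTheory.Balaban1983to89.Beta.Drift (OneLoopDrift)
open Literature.MathematicalPhysics.QuantumFieldTheory.Balaban1983to89.Beta.RateCertificate (GeomRate CauchyRate)
open Literature.MathematicalPhysics.QuantumFieldTheory.Balaban1983to89.Beta.AveragingContoursRooted (ctrOff_mem_box)
open Summit.QuantumFields.YangMills.Theorems.BalabanUVNodesK2JsOfRecord (StepColourData beta0OfJs stepBal_L_pos)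
open Summit.QuantumFields.YangMills.Theorems.BalabanUVNodesK2NamedJetsRemAt (ScaleAnchor)
open Summit.QuantumFields.YangMills.Theorems.BalabanUVNodesK2NamedJetsRunRemAt (RunRemAt RunConstRemainder SurvCont endpointExistence_of_runRemAt_drift endpointExistence_of_drift_runConstRemainder_survCont)
open Summit.QuantumFields.YangMills.Theorems.BalabanUVNodesK2V6Defs (Window13 RunRemAtSomeJets)
open Summit.QuantumFields.YangMills.Theorems.BalabanUVNodesK2NamedJetsLimit (drift_iff_tendsto_stepBal)
open Summit.QuantumFields.BalabanUV.Gaps.CapTailPinnedLimitSign (exists_geomRate_pinned)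
open Summit.QuantumFields.YangMills.BalabanUVNodes.N17RunRemAtOfShiftAnchor (abs_sub_succ_le_of_shiftModulus_scaleAnchor scaleAnchor_upTo cβ_mul_stepBal_pos
  scaleShiftRate_of_n17At_window)
open Summit.QuantumFields.YangMills.BalabanUVNodes.N17RunRemAtOfShiftAnchorLevel (survCont_anti)
open Finset Filter Topology

/-! ## §1 Generic (`β : HBeta`): the lever keyed on SLIDING WINDOWS OF IN-WINDOW RUNS + a corner step -/

section Generic

variable {β : HBeta} {b a e : ℕ → ℝ} {γ : ℝ}

/-- Dropping the first (ultraviolet-most) entry of the window `(g_j, …, g_{j+k+1})` of a coupling sequence gives the window `(g_{j+1}, …, g_{j+k+1})`. [folklore] -/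
theorem tail_prefixOf_shift (gs : ℕ → ℝ) (j k : ℕ) :
    Fin.tail (prefixOf (fun i => gs (j + i)) (k + 1)) = prefixOf (fun i => gs (j + 1 + i)) k := by
  funext i
  simp only [Fin.tail, prefixOf_apply, Fin.val_succ]
  congr 1
  omega

/-- A window of an in-window coupling sequence lies in the box: `Step.InInterval γ n gs`, `j + k ≤ n` ⟹ `(g_j, …, g_{j+k}) ∈ ]0,γ]^{k+1}`. [folklore] -/
theorem prefixOf_shift_mem_box {n : ℕ} {gs : ℕ → ℝ} (hI : Step.InInterval γ n gs) {j k : ℕ} (hjk : j + k ≤ n) :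
    prefixOf (fun i => gs (j + i)) k ∈ Box γ k :=
  mem_box.mpr fun i => hI (j + i) (by have := i.isLt; omega)

/-- **THE «REMAINDER» `β_k(·) − b_k` HAS THE WINDOW SHIFT MODULUS `a_k + e_k`** along the sliding windows of an in-window run: subtract the corner step of the reference numbers
(`|b_{k+1} − b_k| ≤ e_k`) from the run-window shift of the full β (`≤ a_k`).  Both inputs are hypothesis TEXTS (run-window shift: F4-class (i); corner step: F4-class (ii)).
[cite: Balaban1987RG1, (1.20)-(1.22) p.264 and (2.12)-(2.14) p.268] -/
theorem remWindowShift_of_runWindowShift_cornerStep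
    (hW : ∀ (n : ℕ) (gs : ℕ → ℝ), RGEqH n β gs → Step.InInterval γ n gs → ∀ j k : ℕ, j + (k + 1) ≤ n →
      |β (k + 1) (prefixOf (fun i => gs (j + i)) (k + 1)) - β k (prefixOf (fun i => gs (j + 1 + i)) k)| ≤ a k)
    (hb : ∀ k, |b (k + 1) - b k| ≤ e k) {n : ℕ} {gs : ℕ → ℝ} (hrg : RGEqH n β gs) (hI : Step.InInterval γ n gs) {j k : ℕ} (hjk : j + (k + 1) ≤ n) :
    |(β (k + 1) (prefixOf (fun i => gs (j + i)) (k + 1)) - b (k + 1)) - (β k (prefixOf (fun i => gs (j + 1 + i)) k) - b k)| ≤ a k + e k := by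
  have h1 := hW n gs hrg hI j k hjk
  have h2 := hb k
  have e₁ : (β (k + 1) (prefixOf (fun i => gs (j + i)) (k + 1)) - b (k + 1)) - (β k (prefixOf (fun i => gs (j + 1 + i)) k) - b k)
      = (β (k + 1) (prefixOf (fun i => gs (j + i)) (k + 1)) - β k (prefixOf (fun i => gs (j + 1 + i)) k)) - (b (k + 1) - b k) := by ring
  rw [e₁]
  exact (abs_sub _ _).trans (add_le_add h1 h2)

/-- TELESCOPING ALONG ONE IN-WINDOW RUN (peel the ultraviolet-most coupling of the window, `m` times): for every base scale `k₀`,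
`|β_{k₀+m}(g_j,…,g_{j+k₀+m}) − b_{k₀+m}| ≤ |β_{k₀}(g_{j+m},…,g_{j+k₀+m}) − b_{k₀}| + Σ_{i<m} (a_{k₀+i} + e_{k₀+i})`.  (Run-window twin of FILE 1's `rem_iterate_of_remShift`.) [folklore] -/
theorem rem_window_iterate
    (hW : ∀ (n : ℕ) (gs : ℕ → ℝ), RGEqH n β gs → Step.InInterval γ n gs → ∀ j k : ℕ, j + (k + 1) ≤ n →
      |β (k + 1) (prefixOf (fun i => gs (j + i)) (k + 1)) - β k (prefixOf (fun i => gs (j + 1 + i)) k)| ≤ a k)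
    (hb : ∀ k, |b (k + 1) - b k| ≤ e k) {n : ℕ} {gs : ℕ → ℝ} (hrg : RGEqH n β gs) (hI : Step.InInterval γ n gs) (k₀ : ℕ) :
    ∀ m j : ℕ, j + (k₀ + m) ≤ n →
      |β (k₀ + m) (prefixOf (fun i => gs (j + i)) (k₀ + m)) - b (k₀ + m)| ≤
        |β k₀ (prefixOf (fun i => gs (j + m + i)) k₀) - b k₀| + ∑ i ∈ range m, (a (k₀ + i) + e (k₀ + i)) := by
  intro m
  induction m with
  | zero =>
    intro j _
    simp only [Nat.add_zero, Finset.sum_range_zero, add_zero, le_refl]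
  | succ m ih =>
    intro j hj
    have hs := remWindowShift_of_runWindowShift_cornerStep hW hb hrg hI (j := j) (k := k₀ + m) (by omega)
    have ht := ih (j + 1) (by omega)
    have ew : (fun i => gs (j + 1 + m + i)) = fun i => gs (j + (m + 1) + i) := by
      funext i
      congr 1
      omega
    rw [ew] at ht
    have htri : |β (k₀ + m + 1) (prefixOf (fun i => gs (j + i)) (k₀ + m + 1)) - b (k₀ + m + 1)| -
        |β (k₀ + m) (prefixOf (fun i => gs (j + 1 + i)) (k₀ + m)) - b (k₀ + m)| ≤
        |(β (k₀ + m + 1) (prefixOf (fun i => gs (j + i)) (k₀ + m + 1)) - b (k₀ + m + 1)) -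
          (β (k₀ + m) (prefixOf (fun i => gs (j + 1 + i)) (k₀ + m)) - b (k₀ + m))| :=
      abs_sub_abs_le_abs_sub _ _
    rw [Finset.sum_range_succ]
    show |β (k₀ + m + 1) (prefixOf (fun i => gs (j + i)) (k₀ + m + 1)) - b (k₀ + m + 1)| ≤
      |β k₀ (prefixOf (fun i => gs (j + (m + 1) + i)) k₀) - b k₀| + (∑ i ∈ range m, (a (k₀ + i) + e (k₀ + i)) + (a (k₀ + m) + e (k₀ + m)))
    linarith

/-- ★ **THE RUN-KEYED LEVER: a SUMMABLE run-window shift modulus + a SUMMABLE corner step + DEF-1's anchor ⟹ EVERY RUN-WISE CONSTANT REMAINDER at a small enough level** —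
`∀ s > 0 ∃ γ_s ∈ ]0, γ]`, `RunConstRemainder β b s γ_s` (`|β_k(g_0,…,g_k) − b_k| ≤ s` at every prefix of every solution of (0.20) staying in `]0, γ_s]`).  Given `s`: pass to `|a|`
(a run-window bound by `a_k` is one by `|a_k|`; `Summable.abs`), pick `k₀` with the tail `Σ_i (|a|+e)_{k₀+i} < s∕2` (`tendsto_sum_nat_add`), one anchor radius `γ_a` for the scales
`k ≤ k₀` at tolerance `s∕2` (FILE 1's `scaleAnchor_upTo`), and telescope along the run for `k > k₀` (`rem_window_iterate` from the window start `j := 0`): the base window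
`(g_{k−k₀}, …, g_k)` lies in `]0, γ_a]^{k₀+1}` because the run does.  NO box letter is read. [cite: Balaban1987RG1, Thm 3 p.264, (1.20)-(1.22) p.264 and (2.12)-(2.14) p.268] -/
theorem exists_runConstRemainder_of_runWindowShift_cornerStep_scaleAnchor (hγ : 0 < γ) (hA : ScaleAnchor β b)
    (hW : ∀ (n : ℕ) (gs : ℕ → ℝ), RGEqH n β gs → Step.InInterval γ n gs → ∀ j k : ℕ, j + (k + 1) ≤ n →
      |β (k + 1) (prefixOf (fun i => gs (j + i)) (k + 1)) - β k (prefixOf (fun i => gs (j + 1 + i)) k)| ≤ a k)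
    (ha : Summable a) (hb : ∀ k, |b (k + 1) - b k| ≤ e k) (he : Summable e) {s : ℝ} (hs : 0 < s) :
    ∃ γs : ℝ, 0 < γs ∧ γs ≤ γ ∧ RunConstRemainder β b s γs := by
  have hW' : ∀ (n : ℕ) (gs : ℕ → ℝ), RGEqH n β gs → Step.InInterval γ n gs → ∀ j k : ℕ, j + (k + 1) ≤ n →
      |β (k + 1) (prefixOf (fun i => gs (j + i)) (k + 1)) - β k (prefixOf (fun i => gs (j + 1 + i)) k)| ≤ |a k| :=
    fun n gs hrg hI j k hjk => (hW n gs hrg hI j k hjk).trans (le_abs_self _)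
  have hf0 : ∀ k, 0 ≤ |a k| + e k := fun k => add_nonneg (abs_nonneg _) ((abs_nonneg _).trans (hb k))
  have hf : Summable fun k => |a k| + e k := ha.abs.add he
  have htail : Tendsto (fun i => ∑' j, (|a (j + i)| + e (j + i))) atTop (𝓝 0) := tendsto_sum_nat_add fun k => |a k| + e k
  obtain ⟨k₀, hk₀⟩ := (htail.eventually (gt_mem_nhds (half_pos hs))).exists
  obtain ⟨γa, hγa, hanchor⟩ := scaleAnchor_upTo hA k₀ (half_pos hs)
  refine ⟨min γ γa, lt_min hγ hγa, min_le_left _ _, ?_⟩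
  intro n gs hrg hI k hk
  have hIγ : Step.InInterval γ n gs := fun i hi => ⟨(hI i hi).1, (hI i hi).2.trans (min_le_left _ _)⟩
  have hIa : ∀ i, i ≤ n → 0 < gs i ∧ gs i ≤ γa := fun i hi => ⟨(hI i hi).1, (hI i hi).2.trans (min_le_right _ _)⟩
  rcases Nat.lt_or_ge k₀ k with hlt | hge
  · obtain ⟨m, rfl⟩ := Nat.exists_eq_add_of_le hlt.le
    have hiter := rem_window_iterate hW' hb hrg hIγ k₀ m 0 (by omega)
    have e0 : (fun i => gs (0 + i)) = gs := by
      funext i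
      rw [Nat.zero_add]
    have e0m : (fun i => gs (0 + m + i)) = fun i => gs (m + i) := by
      funext i
      rw [Nat.zero_add]
    rw [e0, e0m] at hiter
    have hbase : |β k₀ (prefixOf (fun i => gs (m + i)) k₀) - b k₀| ≤ s / 2 :=
      hanchor k₀ le_rfl _ fun i => hIa (m + i) (by have := i.isLt; omega)
    have hsumk : Summable fun j => |a (j + k₀)| + e (j + k₀) := (summable_nat_add_iff k₀).2 hf
    have hpart : ∑ i ∈ range m, (|a (k₀ + i)| + e (k₀ + i)) ≤ ∑' j, (|a (j + k₀)| + e (j + k₀)) := by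
      have e₁ : ∑ i ∈ range m, (|a (k₀ + i)| + e (k₀ + i)) = ∑ i ∈ range m, (|a (i + k₀)| + e (i + k₀)) :=
        Finset.sum_congr rfl fun i _ => by rw [Nat.add_comm]
      rw [e₁]
      exact hsumk.sum_le_tsum (range m) fun j _ => hf0 _
    have htl : ∑' j, (|a (j + k₀)| + e (j + k₀)) < s / 2 := hk₀
    exact hiter.trans (by linarith)
  · exact (hanchor k hge (prefixOf gs k) fun i => hIa i ((Nat.le_of_lt_succ i.isLt).trans hk)).trans (half_le_self hs.le)

/-- **BOX ⟹ RUN WINDOWS**: a scale-shift modulus on the `]0,γ]`-BOXES (node N17's `ScaleShiftRate` shape, FILE 1's input) restricts to the sliding windows of in-window runs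
(they lie in the box; `tail_prefixOf_shift`).  So the run-window text is WEAKER than the box letter BY NAME. [folklore] -/
theorem runWindowShift_of_boxShift (h : ∀ k (w : Fin (k + 2) → ℝ), w ∈ Box γ (k + 1) → |β (k + 1) w - β k (Fin.tail w)| ≤ a k) :
    ∀ (n : ℕ) (gs : ℕ → ℝ), RGEqH n β gs → Step.InInterval γ n gs → ∀ j k : ℕ, j + (k + 1) ≤ n →
      |β (k + 1) (prefixOf (fun i => gs (j + i)) (k + 1)) - β k (prefixOf (fun i => gs (j + 1 + i)) k)| ≤ a k := by
  intro n gs _ hI j k hjk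
  have h1 := h k (prefixOf (fun i => gs (j + i)) (k + 1)) (prefixOf_shift_mem_box hI hjk)
  rwa [tail_prefixOf_shift] at h1

/-- **FILE 1's LEVER FACTORS THROUGH THE RUN-KEYED ONE**: the box letter + the anchor give the run-window modulus (`runWindowShift_of_boxShift`) AND the corner step with the same
modulus (FILE 1's `abs_sub_succ_le_of_shiftModulus_scaleAnchor`), hence every run-wise constant remainder — without passing through the box `ConstRemainder`.
[cite: Balaban1987RG1, (2.12)-(2.14) p.268 and Thm 3 p.264] -/
theorem exists_runConstRemainder_of_boxShift_scaleAnchor (hγ : 0 < γ) (hA : ScaleAnchor β b)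
    (h : ∀ k (w : Fin (k + 2) → ℝ), w ∈ Box γ (k + 1) → |β (k + 1) w - β k (Fin.tail w)| ≤ a k) (ha : Summable a) {s : ℝ} (hs : 0 < s) :
    ∃ γs : ℝ, 0 < γs ∧ γs ≤ γ ∧ RunConstRemainder β b s γs :=
  exists_runConstRemainder_of_runWindowShift_cornerStep_scaleAnchor hγ hA (runWindowShift_of_boxShift h) ha
    (abs_sub_succ_le_of_shiftModulus_scaleAnchor hγ hA h) ha hs

/-- **THE RUN LETTER's SHAPE from «every run-wise constant» + a POSITIVE cap + (C) AT ONE LEVEL**: `∃ γ₁ s, 0 < γ₁ ≤ γ ∧ s ≤ S ∧ RunConstRemainder β b s γ₁ ∧ ScaleAnchor β b ∧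
SurvCont β γ₁` — DEF-1's `RunRemAt` body over abstract `(β, b, γ, S)`; the cap met with EQUALITY, the level moved down to `min γ_S γ₀` (FILE 2's `survCont_anti`). [folklore] -/
theorem exists_runLetters_of_everyRunConst_survContAt {S : ℝ} (hS : 0 < S) (hA : ScaleAnchor β b)
    (hev : ∀ s : ℝ, 0 < s → ∃ γs : ℝ, 0 < γs ∧ γs ≤ γ ∧ RunConstRemainder β b s γs)
    {γ₀ : ℝ} (hγ₀ : 0 < γ₀) (hsc : SurvCont β γ₀) :
    ∃ γ₁ s : ℝ, 0 < γ₁ ∧ γ₁ ≤ γ ∧ s ≤ S ∧ RunConstRemainder β b s γ₁ ∧ ScaleAnchor β b ∧ SurvCont β γ₁ := by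
  obtain ⟨γs, hγs, hγsγ, hrem⟩ := hev S hS
  exact ⟨min γs γ₀, S, lt_min hγs hγ₀, (min_le_left _ _).trans hγsγ, le_rfl, hrem.mono (min_le_left _ _), hA,
    survCont_anti (lt_min hγs hγ₀) (min_le_right _ _) hsc⟩

/-- ★ **END, GENERIC AND RUN-KEYED ON BOTH SIDES**: a forward-generated construction, a summable RUN-WINDOW shift modulus of its β-family at level `γ`, DEF-1's anchor at numbers `b`
with a summable corner step and drifting with a POSITIVE slope `s₀`, and survivor continuity at ONE positive level ⟹ `EndpointExistence C` (the lever at `s := s₀` feeds DEF-1's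
`endpointExistence_of_drift_runConstRemainder_survCont`, pub-balaban-gaps' `EndSurvivorCensus` inside).  CONDITIONAL; nothing of Bałaban asserted.
[cite: Balaban1987RG1, Thm 2 p.259 (first sentence), (2.12)-(2.14) p.268 and Thm 3 p.264] -/
theorem endpointExistence_of_runWindowShift_cornerStep_scaleAnchor_drift_survContAt {C : B12.Construction} (hgen : ForwardGenerated C β) (hγ : 0 < γ)
    (hA : ScaleAnchor β b)
    (hW : ∀ (n : ℕ) (gs : ℕ → ℝ), RGEqH n β gs → Step.InInterval γ n gs → ∀ j k : ℕ, j + (k + 1) ≤ n →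
      |β (k + 1) (prefixOf (fun i => gs (j + i)) (k + 1)) - β k (prefixOf (fun i => gs (j + 1 + i)) k)| ≤ a k)
    (ha : Summable a) (hb : ∀ k, |b (k + 1) - b k| ≤ e k) (he : Summable e)
    {s₀ A : ℝ} (hs₀ : 0 < s₀) (hdrift : OneLoopDrift s₀ A b) {γ₀ : ℝ} (hγ₀ : 0 < γ₀) (hsc : SurvCont β γ₀) :
    EndpointExistence C := by
  obtain ⟨γs, hγs, -, hrem⟩ := exists_runConstRemainder_of_runWindowShift_cornerStep_scaleAnchor hγ hA hW ha hb he hs₀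
  exact endpointExistence_of_drift_runConstRemainder_survCont hgen (lt_min hγs hγ₀) hdrift (hrem.mono (min_le_left _ _)) le_rfl
    (survCont_anti (lt_min hγs hγ₀) (min_le_right _ _) hsc)

end Generic

/-! ## §2 The NAMED one-loop numbers `beta0OfJs F κ`: geometric rate and CORNER STEP — HYPOTHESIS-FREE (g1-p3 ∕ gan24-p1 BY NAME; convergence itself = `…K2NamedJetsLimit.tendsto_beta0OfJs`) -/

section Named

variable (F : T4Family) (κ : StepColourData)

/-- **A GEOMETRIC RATE AT THE LIMIT, HYPOTHESIS-FREE**: `∃ c₀ θ, 0 ≤ θ < 1 ∧ ∀ k, |beta0OfJs F κ k − lim| ≤ c₀·θ^k` (g1-p3's `exists_geomRate_pinned`; the constants sit inside the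
tree's `∃`). [folklore] -/
theorem exists_geomRate_beta0OfJs : ∃ c₀ θ : ℝ, 0 ≤ θ ∧ θ < 1 ∧ GeomRate (beta0OfJs F κ) (CauchyRate.lim (beta0OfJs F κ)) c₀ θ := by
  haveI : NeZero F.L := ⟨by have := F.hL.2; omega⟩
  exact exists_geomRate_pinned F.hL.2 (ctrOff_mem_box F.hL.2.le) κ.cE κ.cVH κ.cΛ κ.cB κ.Tc 0 1

/-- **THE CORNER STEP OF THE SCALED NAMED NUMBERS IS SUMMABLE, HYPOTHESIS-FREE**: for every scale factor `c`, `∃ e, Summable e ∧ ∀ k, |c·b_{k+1} − c·b_k| ≤ e_k` with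
`b := beta0OfJs F κ` (`e_k := |c|·2c₀·θ^k` from the geometric rate).  So in the run-keyed lever AT THE NAMED JETS the corner-step input costs nothing. [folklore] -/
theorem exists_cornerStep_smul_beta0OfJs (c : ℝ) :
    ∃ e : ℕ → ℝ, Summable e ∧ ∀ k, |c * beta0OfJs F κ (k + 1) - c * beta0OfJs F κ k| ≤ e k := by
  obtain ⟨c₀, θ, hθ0, hθ1, h⟩ := exists_geomRate_beta0OfJs F κ
  have hc₀ : 0 ≤ c₀ := h.const_nonneg
  refine ⟨fun k => |c| * (2 * c₀ * θ ^ k), ((summable_geometric_of_lt_one hθ0 hθ1).mul_left (2 * c₀)).mul_left |c|, fun k => ?_⟩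
  have h1 := h (k + 1)
  have h2 := h k
  have hθk : θ ^ (k + 1) ≤ θ ^ k := by
    rw [pow_succ]
    exact mul_le_of_le_one_right (pow_nonneg hθ0 k) hθ1.le
  rw [← mul_sub, abs_mul]
  refine mul_le_mul_of_nonneg_left ?_ (abs_nonneg c)
  calc |beta0OfJs F κ (k + 1) - beta0OfJs F κ k|
      ≤ |beta0OfJs F κ (k + 1) - CauchyRate.lim (beta0OfJs F κ)| + |CauchyRate.lim (beta0OfJs F κ) - beta0OfJs F κ k| := abs_sub_le _ _ _
    _ ≤ c₀ * θ ^ (k + 1) + c₀ * θ ^ k := add_le_add h1 (by rw [abs_sub_comm]; exact h2)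
    _ ≤ c₀ * θ ^ k + c₀ * θ ^ k := add_le_add (mul_le_mul_of_nonneg_left hθk hc₀) le_rfl
    _ = 2 * c₀ * θ ^ k := by ring

end Named

/-! ## §3 At NODE 00's Stage-13 record (`N = 2`): the run-window shift of the datum's β + the anchor at the NAMED numbers + one-level (C) ⟹ DEF-1's `RunRemAt` -/

section Record

open YMDAG.UVSplit (U3Carriers N17At)

variable (F : T4Family) (κ : StepColourData) (θ : Node00.Stage13HParams F 2) (hP : θ.Provisos₁₃SepCoPH F 2)

/-- ★★ **THE RUN-KEYED JUNCTION TO THE REGISTERED RUN LETTER.**  At an admissible proviso'd Stage-13 tuple: a SUMMABLE scale-shift modulus of the datum's β read ONLY ALONG THE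
SLIDING WINDOWS OF ITS IN-WINDOW RUNS of level `θ.γ` + DEF-1's ANCHOR at the named numbers `θ.cβ · beta0OfJs F κ` + survivor continuity at ONE positive level ⟹
`RunRemAt F κ θ hP θ.cβ` — 2ᴮ″'s letter, cap met with equality (`0 < θ.cβ·stepBal 2 F.L`, FILE 1's `cβ_mul_stepBal_pos`).  The corner step of the scaled named numbers is supplied
by the TREE (§2, hypothesis-free); NO box letter, NO `Fin.tail` on off-run histories.  CONDITIONAL; the run-window shift ∕ the anchor ∕ (C) NOT proved.
[cite: Balaban1987RG1, Thm 3 p.264, (1.20)-(1.22) p.264 and (2.12)-(2.14) p.268] -/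
theorem runRemAt_of_runWindowShift_scaleAnchor_survContAt (hθ : θ.Admissible F 2) {a : ℕ → ℝ} (ha : Summable a)
    (hW : ∀ (n : ℕ) (gs : ℕ → ℝ), RGEqH n (Node00.datumOfRecord₁₃SepCoPH F 2 θ hP).βfun gs → Step.InInterval θ.γ n gs → ∀ j k : ℕ, j + (k + 1) ≤ n →
      |(Node00.datumOfRecord₁₃SepCoPH F 2 θ hP).βfun (k + 1) (prefixOf (fun i => gs (j + i)) (k + 1)) -
        (Node00.datumOfRecord₁₃SepCoPH F 2 θ hP).βfun k (prefixOf (fun i => gs (j + 1 + i)) k)| ≤ a k)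
    (hA : ScaleAnchor (Node00.datumOfRecord₁₃SepCoPH F 2 θ hP).βfun (fun k => θ.cβ * beta0OfJs F κ k))
    {γ₀ : ℝ} (hγ₀ : 0 < γ₀) (hsc : SurvCont (Node00.datumOfRecord₁₃SepCoPH F 2 θ hP).βfun γ₀) :
    RunRemAt F κ θ hP θ.cβ := by
  have hγ : 0 < θ.γ := hθ.toStage12.toStage9.gamma_pos
  obtain ⟨e, he, hb⟩ := exists_cornerStep_smul_beta0OfJs F κ θ.cβ
  exact exists_runLetters_of_everyRunConst_survContAt (cβ_mul_stepBal_pos F θ hθ) hA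
    (fun s hs => exists_runConstRemainder_of_runWindowShift_cornerStep_scaleAnchor hγ hA hW ha hb he hs) hγ₀ hsc

/-- ★★ **GIVEN A SUMMABLE RUN-WINDOW SHIFT AT THE TUPLE, `RunRemAt F κ θ hP θ.cβ` IS EXACTLY «κ ANCHORS ∧ (C) AT SOME POSITIVE LEVEL»** (FILE 2's
`runRemAt_iff_anchor_survCont_of_n17At` with node N17's box letter replaced by the run-window text).  CONDITIONAL.
[cite: Balaban1987RG1, Thm 3 p.264 and (2.12)-(2.14) p.268] -/
theorem runRemAt_iff_anchor_survCont_of_runWindowShift (hθ : θ.Admissible F 2) {a : ℕ → ℝ} (ha : Summable a)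
    (hW : ∀ (n : ℕ) (gs : ℕ → ℝ), RGEqH n (Node00.datumOfRecord₁₃SepCoPH F 2 θ hP).βfun gs → Step.InInterval θ.γ n gs → ∀ j k : ℕ, j + (k + 1) ≤ n →
      |(Node00.datumOfRecord₁₃SepCoPH F 2 θ hP).βfun (k + 1) (prefixOf (fun i => gs (j + i)) (k + 1)) -
        (Node00.datumOfRecord₁₃SepCoPH F 2 θ hP).βfun k (prefixOf (fun i => gs (j + 1 + i)) k)| ≤ a k) :
    RunRemAt F κ θ hP θ.cβ ↔
      ScaleAnchor (Node00.datumOfRecord₁₃SepCoPH F 2 θ hP).βfun (fun k => θ.cβ * beta0OfJs F κ k) ∧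
        ∃ γ₀ : ℝ, 0 < γ₀ ∧ SurvCont (Node00.datumOfRecord₁₃SepCoPH F 2 θ hP).βfun γ₀ := by
  constructor
  · rintro ⟨γ₀, s, hγ₀, -, -, -, hA', hsc⟩
    exact ⟨hA', γ₀, hγ₀, hsc⟩
  · rintro ⟨hA', γ₀, hγ₀, hsc⟩
    exact runRemAt_of_runWindowShift_scaleAnchor_survContAt F κ θ hP hθ ha hW hA' hγ₀ hsc

/-- **NODE N17 ⟹ THE RUN-WINDOW TEXT** (with the geometric modulus `a_k := (u.cr·u.C₅·u.θ)·u.ρ^k`): N17 on the datum of record at a bundle with window `u.γ = θ.γ` IS the BOX letter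
`ScaleShiftRate … θ.γ D.βfun` (`YMDAG.UVSplit.N17At`, `rfl`), which restricts to run windows (`runWindowShift_of_boxShift`).  So FILE 2's `runRemAt_of_n17At_scaleAnchor_survContAt` is
★★ above ∘ this (for `0 ≤ u.ρ < 1` the modulus is summable).  CONDITIONAL. [cite: Balaban1987RG1, (1.20)-(1.22) p.264] -/
theorem runWindowShift_of_n17At {u : U3Carriers} (hγu : u.γ = θ.γ) (h17 : N17At (Node00.datumOfRecord₁₃SepCoPH F 2 θ hP) u) :
    ∀ (n : ℕ) (gs : ℕ → ℝ), RGEqH n (Node00.datumOfRecord₁₃SepCoPH F 2 θ hP).βfun gs → Step.InInterval θ.γ n gs → ∀ j k : ℕ, j + (k + 1) ≤ n →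
      |(Node00.datumOfRecord₁₃SepCoPH F 2 θ hP).βfun (k + 1) (prefixOf (fun i => gs (j + i)) (k + 1)) -
        (Node00.datumOfRecord₁₃SepCoPH F 2 θ hP).βfun k (prefixOf (fun i => gs (j + 1 + i)) k)| ≤ u.cr * u.C₅ * u.θ * u.ρ ^ k :=
  runWindowShift_of_boxShift (a := fun k => u.cr * u.C₅ * u.θ * u.ρ ^ k) (scaleShiftRate_of_n17At_window F θ hP hγu h17)

end Record

/-! ## §4 Text level (K2⁷ v6's full prefix, `Window13` as DEF-1's tree def spells it): the registered 2ᴮ″ and the crux decl BY NAME from the RUN-WINDOW text -/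

section Texts

/-- ★★★ **THE REGISTERED 2ᴮ″ TEXT `RunRemAtSomeJets` (DEF-1's tree def, = `stub_runRemNamedJets13`'s signature) BY NAME FROM TWO TEXTS on the crux's full prefix:
(RW13) «the datum's β has a SUMMABLE scale-shift modulus along the sliding windows of its in-window runs of level `θ.γ`» and (AS13) «SOME colour datum's scaled named numbers ANCHOR
the record, with survivor continuity at one positive level».**  MODULO THE RUN-WINDOW N17 TEXT, K2⁷'s XL stub 2ᴮ″ is thus EXACTLY identification + one-level (C) (the corner step is
the tree's).  CONDITIONAL on both displayed texts; NOT a proof of `stub_runRemNamedJets13`. [cite: Balaban1987RG1, Thm 3 p.264, (1.20)-(1.22) p.264 and (2.12)-(2.14) p.268] -/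
theorem runRemAtSomeJets_of_runWindowShift13_anchorSurv13
    (hW : ∀ (F : T4Family) (θ : Node00.Stage13HParams F 2) (hP : θ.Provisos₁₃SepCoPH F 2), (θ.ZhUnity F 2 ∧ θ.SlotsNondegenerate₁₃ F 2) → θ.Admissible F 2 →
      B16.EndStatementBPrinted (Node00.datumOfRecord₁₃SepCoPH F 2 θ hP).C → Window13 F θ hP →
      ∃ a : ℕ → ℝ, Summable a ∧
        ∀ (n : ℕ) (gs : ℕ → ℝ), RGEqH n (Node00.datumOfRecord₁₃SepCoPH F 2 θ hP).βfun gs → Step.InInterval θ.γ n gs → ∀ j k : ℕ, j + (k + 1) ≤ n →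
          |(Node00.datumOfRecord₁₃SepCoPH F 2 θ hP).βfun (k + 1) (prefixOf (fun i => gs (j + i)) (k + 1)) -
            (Node00.datumOfRecord₁₃SepCoPH F 2 θ hP).βfun k (prefixOf (fun i => gs (j + 1 + i)) k)| ≤ a k)
    (hAS : ∀ (F : T4Family) (θ : Node00.Stage13HParams F 2) (hP : θ.Provisos₁₃SepCoPH F 2), (θ.ZhUnity F 2 ∧ θ.SlotsNondegenerate₁₃ F 2) → θ.Admissible F 2 →
      B16.EndStatementBPrinted (Node00.datumOfRecord₁₃SepCoPH F 2 θ hP).C → Window13 F θ hP →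
      ∃ κ : StepColourData, ScaleAnchor (Node00.datumOfRecord₁₃SepCoPH F 2 θ hP).βfun (fun k => θ.cβ * beta0OfJs F κ k) ∧
        ∃ γ₀ : ℝ, 0 < γ₀ ∧ SurvCont (Node00.datumOfRecord₁₃SepCoPH F 2 θ hP).βfun γ₀) :
    RunRemAtSomeJets := by
  intro F θ hP hU hθ hB hwin
  obtain ⟨a, ha, hWF⟩ := hW F θ hP hU hθ hB hwin
  obtain ⟨κ, hA, γ₀, hγ₀, hsc⟩ := hAS F θ hP hU hθ hB hwin
  exact ⟨κ, runRemAt_of_runWindowShift_scaleAnchor_survContAt F κ θ hP hθ ha hWF hA hγ₀ hsc⟩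

/-- ★★★ **THE K2⁷ CRUX DECL BY NAME (`Summit.QuantumFields.YangMills.Theses.BalabanUVNodes.EndpointGivenBR13SepCoPH`) FROM THE RUN-WINDOW TEXT (RW13) + ONE LOCATED TEXT «at every
tuple SOME colour datum κ anchors the record's β, with survivor continuity at one positive level, AND its named one-loop numbers tend to `stepBal 2 F.L`»** — per tuple: the run letter
(§3 ★★), the bare drift from the hypothesis-free junction `…K2NamedJetsLimit.drift_iff_tendsto_stepBal` (ym-nodeO-d1-w1 ∕ idea-7 §9.1), DEF-1's `endpointExistence_of_runRemAt_drift`.  THE LOCATED RESIDUE OF K2⁷ MODULO THE RUN-WINDOW N17 TEXT: identification +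
one-level (C) + the VALUE of the named limit (ONE real-number identity `CauchyRate.lim (beta0OfJs F κ) = stepBal 2 F.L` per `(F, κ)`).  CONDITIONAL on both displayed texts; K2⁷ NOT
closed; nothing of Bałaban asserted. [cite: Balaban1987RG1, Thm 2 p.259 (first sentence), (1.3) p.260, Thm 3 p.264 and (2.12)-(2.14) p.268] -/
theorem EndpointGivenBR13SepCoPH_of_runWindowShift13_anchorSurvLimit13
    (hW : ∀ (F : T4Family) (θ : Node00.Stage13HParams F 2) (hP : θ.Provisos₁₃SepCoPH F 2), (θ.ZhUnity F 2 ∧ θ.SlotsNondegenerate₁₃ F 2) → θ.Admissible F 2 →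
      B16.EndStatementBPrinted (Node00.datumOfRecord₁₃SepCoPH F 2 θ hP).C → Window13 F θ hP →
      ∃ a : ℕ → ℝ, Summable a ∧
        ∀ (n : ℕ) (gs : ℕ → ℝ), RGEqH n (Node00.datumOfRecord₁₃SepCoPH F 2 θ hP).βfun gs → Step.InInterval θ.γ n gs → ∀ j k : ℕ, j + (k + 1) ≤ n →
          |(Node00.datumOfRecord₁₃SepCoPH F 2 θ hP).βfun (k + 1) (prefixOf (fun i => gs (j + i)) (k + 1)) -
            (Node00.datumOfRecord₁₃SepCoPH F 2 θ hP).βfun k (prefixOf (fun i => gs (j + 1 + i)) k)| ≤ a k)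
    (hASL : ∀ (F : T4Family) (θ : Node00.Stage13HParams F 2) (hP : θ.Provisos₁₃SepCoPH F 2), (θ.ZhUnity F 2 ∧ θ.SlotsNondegenerate₁₃ F 2) → θ.Admissible F 2 →
      B16.EndStatementBPrinted (Node00.datumOfRecord₁₃SepCoPH F 2 θ hP).C → Window13 F θ hP →
      ∃ κ : StepColourData, ScaleAnchor (Node00.datumOfRecord₁₃SepCoPH F 2 θ hP).βfun (fun k => θ.cβ * beta0OfJs F κ k) ∧
        (∃ γ₀ : ℝ, 0 < γ₀ ∧ SurvCont (Node00.datumOfRecord₁₃SepCoPH F 2 θ hP).βfun γ₀) ∧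
        Tendsto (beta0OfJs F κ) atTop (𝓝 (B12Normalization.stepBal 2 F.L))) :
    Summit.QuantumFields.YangMills.Theses.BalabanUVNodes.EndpointGivenBR13SepCoPH := by
  intro F θ hP hU hθ hB hwin
  obtain ⟨a, ha, hWF⟩ := hW F θ hP hU hθ hB hwin
  obtain ⟨κ, hA, ⟨γ₀, hγ₀, hsc⟩, hlim⟩ := hASL F θ hP hU hθ hB hwin
  have hRun : RunRemAt F κ θ hP θ.cβ := runRemAt_of_runWindowShift_scaleAnchor_survContAt F κ θ hP hθ ha hWF hA hγ₀ hsc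
  obtain ⟨A, hdrift⟩ := (drift_iff_tendsto_stepBal F κ 2).2 hlim
  exact endpointExistence_of_runRemAt_drift F κ θ hP hRun hdrift

end Texts

end Summit.QuantumFields.YangMills.BalabanUVNodes.N17RunWindowShift

end
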